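import Summits.QuantumFields.YangMills.Theorems.BalabanUVNodesN15TwoGridDressedJetL2
import HarnessLib

/-!
# N15 (NE2) — PROGRAMME K, part K-H: ★★★ THE DRESSED GRADIENT OF BAŁABAN's PAIR `(Δ′_a⁻¹, Δ_a⁻¹)` UNDER THE (3.35) PAIR ALONE, IN (sup → L²-BLOCK) CURRENCY, HYPOTHESIS-FREE —
# K-G's rows theorem fired on the torus family of record: (1.110) ∕ (1.114) rows, parts 52∕59 defects, M-C and K-E `c′`-rows; no letter on `∇c′`, no fit of `c′`, no level decomposition

WHO ∕ WHEN.  Cell `pub-ymgap`, seat `pub-ymgap-dag-n15-a` (KNIT-BY-NAME seat of Track-A DAG node N15 = NE2, g25); `--kind proof --supports stmt-QuantumFields-27366 --as helper` (K3⁸;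
count-neutral).  THEOREMS ONLY (0 `def`).  Over K-G `…TwoGridDressedJetL2` (★★ `hasMajL2_idef_bgPair_of_rows`), K-E (★★★ `hasMajL2_gGrad_comp_idef_mulOp_blockAvg`), K-F (★ `hasMajL2_gOp_pair`),
M-C ★★★ `hasMaj_comp_idef_mulOp_blockAvg_of_divAdj`, parts 42 (`ineq110_114_pair`, `hasMaj_gOp∕grad∕gDivAdj_of_ineq`), 52 (`hasMaj_twoGridDefect`), 59 (`hasMaj_twoGridDefect_grad`), 61 (`HasMaj.to_l2Blocks`),
68 (`etaPow_mul_card_fineBond`), `B6UnitTorusCarrier.rowSum_unitTorusGeo` BY NAME; nothing in the tree is modified.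

WHAT.  §12 `jetL2_const_bound` (constants against the two Neumann guards), ★★★ `hasMajL2_idef_bgPair_gOp (hLodd : Odd L) (hL3 : 3 ≤ L) (ha : 0 < a) : ∃ δ r₀ B > 0, ∀ m_T k m (1 ≤ k) (hL) r ∈ [0, r₀]
o_a ≥ 0 (c′, a′) with |c′|, |a′_μ| ≤ r, |a′_μ − ā_μ∘kingPrV| ≤ o_a:
HasMaj (ofBlocks (unitTorusGeo L k M) (blkFine L k M)) (l2Blocks (unitTorusGeo L k M) (blkPair (blockOf (L^m·L^k) M ∘ fst)) η′^{d+1})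
(𝔇_{(kingPrV, liftPair kingPrV)}(bgPair Δ′_a⁻¹ (ρ′(sD′_μ)∘Δ′_a⁻¹)_μ c′ a′, bgPair Δ_a⁻¹ (ρ(sD_μ)∘Δ_a⁻¹)_μ c̄ ā)) (B·((L^k)^{−1∕16} + r·(L^k)⁻¹ + o_a)·e^{−δ|y−y′|_T})`, `M = MP (paramsOf d L m_T k hL)` — the η-defect of the
WHOLE first-order dressed jet (value AND gradient) of the PAIR OF RECORD, HYPOTHESIS-FREE; ★★ `hasMajL2_projO_idef_bgPair_gOp`: every component — `some ν` = THE DRESSED GRADIENT ENTRY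
`𝔇(∇′_νX′, ∇_νX̄)`, `none` = the value entry — from King's coarse sup-blocks to the fine L²-blocks.

HONEST FRAMING ∕ LIMITS.  The OUTPUT is measured in the L²-BLOCK norm — NOT the sup entry [B9] (3.42) prints; the sup upgrade (parts 70∕71's sub-box interpolation with the (1.111) oscillation
rows of `∇′G′`; rate loss to a root) and the II-E-pattern `NE2PlusOperator` packaging for the pair of record remain LOCATED — the honest statement of what this file does NOT do.  `U ≡ 1`
Landau-gauge pair on the torus family of record (b05 model of [B5] (1.69)–(1.71)); abelianised scalar-multiplier MODEL of (3.52)'s `V′(A)`, block-averaged coarse partner (C3); letters on `(c′, a′)`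
= sups + ONE fit of `a′`; the rate `(L^k)^{−1∕16}` is part 59's currency artefact.  NE2⁺ NOT printed ∕ NOT proved; no statement of record touched; N15 NOT discharged; K3⁸ OPEN; counts UNMOVED
(typed 28∕28 · discharged 5∕27); one finite torus per index — NOT ℝ⁴ ∕ infinite volume ∕ OS ∕ mass gap ∕ Clay.  ONE declared `set_option maxHeartbeats 800000 in` on ★★★ (elaboration
of the long statement + the constants bookkeeping; farm ≈ 45 s for the file).
-/

noncomputable section

open scoped BigOperators
open Finset

namespace Summit.QuantumFields.YangMills.BalabanUVNodes.N15.TwoGrid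

open Literature.MathematicalPhysics.QuantumFieldTheory.Balaban1983to89
open Literature.MathematicalPhysics.QuantumFieldTheory.Balaban1983to89.B11SectG (BlockNorm HasMaj hasMaj_comp hasMaj_comp_exp RowSum)
open Literature.MathematicalPhysics.QuantumFieldTheory.Balaban1983to89.T4EtaRateDefect (idef idef_apply)
open Literature.MathematicalPhysics.QuantumFieldTheory.Balaban1983to89.T4EtaRateCoeffDefect (pull pull_apply diagK blockAvg hasMaj_idef_mulOp)
open Literature.MathematicalPhysics.QuantumFieldTheory.Balaban1983to89.B9SectDWeightedNeumann (WRow wrow_of_exp)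
open Literature.MathematicalPhysics.QuantumFieldTheory.Balaban1983to89.B6RandomWalk (Triangle254)
open Literature.MathematicalPhysics.QuantumFieldTheory.Balaban1983to89.B6Prop26Gluing (mulOp mulOp_apply)
open Literature.MathematicalPhysics.QuantumFieldTheory.Balaban1983to89.B5Prop11Plancherel (Tor fine unitVec)
open Literature.MathematicalPhysics.QuantumFieldTheory.Balaban1983to89.B5SiteBridgeP12 (MP)
open Literature.MathematicalPhysics.QuantumFieldTheory.Balaban1983to89.B5SettingP12Weighted (etaPow etaPow_nonneg)
open Literature.MathematicalPhysics.QuantumFieldTheory.King1986.Torus (blockOf tdistT tdistT_nonneg)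
open Literature.MathematicalPhysics.QuantumFieldTheory.Balaban1983to89.B6UnitTorusCarrier (unitTorusGeo triangle254_unitTorusGeo rowSum_unitTorusGeo)
open Summit.QuantumFields.YangMills.BalabanUVNodes.N15.VectorPiece (blkFine kingPrV blkFine_comp_kingPrV)
open Summit.QuantumFields.YangMills.BalabanUVNodes.N15.BackgroundModel (kappa_ofBlocks)
open Summit.QuantumFields.YangMills.BalabanUVNodes.N15.BackgroundStep (idef_background_propagator_majorant_flat)
open Summit.QuantumFields.YangMills.BalabanUVNodes.N15.BackgroundLayer (bgPropV bgPropV_fix isUnit_stepV hasMaj_bgPropV hasMaj_V_bgPropV stack unstack projO liftPair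
  blkPair bgPair idef_stack hasMaj_stack hasMaj_unstack hasMaj_projO_comp abs_blockAvg_le)

variable {d : ℕ}

/-! ## §12 ★★★ Hypothesis-free for Bałaban's Landau-gauge pair on the torus family of record -/

section Balaban

/-- g0's total constant at `m_G = C_θθ`, `ζ₀ = C₀rx`, `ζ = C_Erx`, `B_X = 2β`, the sup jet factor `βq` with `q ≤ 2`, the L² Neumann factor `q₂ ≤ 2`, `r ≤ r₀`: `≤ B·(θ + rx + o_a)`. [folklore] -/
theorem jetL2_const_bound {s u θ x r r₀ oa β cr Cθ C₀ CE q q₂ : ℝ} (hs : 0 ≤ s) (hu : 0 ≤ u) (hθ : 0 ≤ θ) (hx : 0 ≤ x) (hr : 0 ≤ r) (hrr₀ : r ≤ r₀) (hoa : 0 ≤ oa) (hβ : 0 ≤ β)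
    (hcr : 0 ≤ cr) (hCθ : 0 ≤ Cθ) (hC₀ : 0 ≤ C₀) (hCE : 0 ≤ CE) (hq : 0 ≤ q) (hq2 : q ≤ 2) (hq₂ : 0 ≤ q₂) (hq₂2 : q₂ ≤ 2) :
    ((s + 2) * (Cθ * θ) * cr + 1 * ((s + 2) * (Cθ * θ) * cr) * (r * (s + 2) * (β * q)) + (s + 2) * ((C₀ * r * x + CE * r * x + (s + 1) * (u * β * oa)) * (2 * β) * cr)) * q₂
      ≤ (2 * (s + 2) * cr * (Cθ * (1 + 2 * β * r₀ * (s + 2)) + 2 * β * (C₀ + CE) + 2 * β * (s + 1) * u * β) + 1) * (θ + r * x + oa) := by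
  have hr₀ : 0 ≤ r₀ := hr.trans hrr₀
  have hrx : 0 ≤ r * x := mul_nonneg hr hx
  have A0 : 0 ≤ (s + 2) * (Cθ * θ) * cr := by positivity
  have T1 : (s + 2) * (Cθ * θ) * cr * q₂ ≤ 2 * (s + 2) * cr * Cθ * θ := by nlinarith
  have T2 : 1 * ((s + 2) * (Cθ * θ) * cr) * (r * (s + 2) * (β * q)) * q₂ ≤ 2 * (s + 2) * cr * (Cθ * (2 * β * r₀ * (s + 2))) * θ := by
    have h1 : r * (s + 2) * (β * q) ≤ r₀ * (s + 2) * (β * 2) :=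
      mul_le_mul (mul_le_mul_of_nonneg_right hrr₀ (by linarith)) (mul_le_mul_of_nonneg_left hq2 hβ) (by positivity) (by positivity)
    calc 1 * ((s + 2) * (Cθ * θ) * cr) * (r * (s + 2) * (β * q)) * q₂ ≤ 1 * ((s + 2) * (Cθ * θ) * cr) * (r₀ * (s + 2) * (β * 2)) * 2 :=
          mul_le_mul (mul_le_mul_of_nonneg_left h1 (by positivity)) hq₂2 hq₂ (by positivity)
      _ = 2 * (s + 2) * cr * (Cθ * (2 * β * r₀ * (s + 2))) * θ := by ring
  have T3 : (s + 2) * ((C₀ * r * x + CE * r * x + (s + 1) * (u * β * oa)) * (2 * β) * cr) * q₂ ≤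
      2 * (s + 2) * cr * (2 * β * (C₀ + CE)) * (r * x) + 2 * (s + 2) * cr * (2 * β * (s + 1) * u * β) * oa := by
    have h0 : 0 ≤ (s + 2) * ((C₀ * r * x + CE * r * x + (s + 1) * (u * β * oa)) * (2 * β) * cr) := by positivity
    calc (s + 2) * ((C₀ * r * x + CE * r * x + (s + 1) * (u * β * oa)) * (2 * β) * cr) * q₂
        ≤ (s + 2) * ((C₀ * r * x + CE * r * x + (s + 1) * (u * β * oa)) * (2 * β) * cr) * 2 := mul_le_mul_of_nonneg_left hq₂2 h0
      _ = 2 * (s + 2) * cr * (2 * β * (C₀ + CE)) * (r * x) + 2 * (s + 2) * cr * (2 * β * (s + 1) * u * β) * oa := by ring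
  have hsum : ((s + 2) * (Cθ * θ) * cr + 1 * ((s + 2) * (Cθ * θ) * cr) * (r * (s + 2) * (β * q)) + (s + 2) * ((C₀ * r * x + CE * r * x + (s + 1) * (u * β * oa)) * (2 * β) * cr)) * q₂
      = (s + 2) * (Cθ * θ) * cr * q₂ + 1 * ((s + 2) * (Cθ * θ) * cr) * (r * (s + 2) * (β * q)) * q₂ +
        (s + 2) * ((C₀ * r * x + CE * r * x + (s + 1) * (u * β * oa)) * (2 * β) * cr) * q₂ := by ring
  rw [hsum]
  have E1 : 0 ≤ 2 * (s + 2) * cr * Cθ := by positivity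
  have E2 : 0 ≤ 2 * (s + 2) * cr * (Cθ * (2 * β * r₀ * (s + 2))) := by positivity
  have E3 : 0 ≤ 2 * (s + 2) * cr * (2 * β * (C₀ + CE)) := by positivity
  have E4 : 0 ≤ 2 * (s + 2) * cr * (2 * β * (s + 1) * u * β) := by positivity
  nlinarith [mul_nonneg E1 hrx, mul_nonneg E1 hoa, mul_nonneg E2 hrx, mul_nonneg E2 hoa, mul_nonneg E3 hθ, mul_nonneg E3 hoa, mul_nonneg E4 hθ, mul_nonneg E4 hrx, hθ, hrx, hoa]

variable (d) {L : ℕ} [NeZero L]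

set_option maxHeartbeats 800000 in
/-- ★★★ **THE η-DEFECT OF THE WHOLE FIRST-ORDER DRESSED JET OF BAŁABAN's PAIR `(Δ′_a⁻¹, Δ_a⁻¹)` IN (sup → L²-BLOCK) CURRENCY, HYPOTHESIS-FREE, NO LETTER ON `∇c′`, NO FIT OF `c′`.**  See the module
docstring (WHAT).  Rows: (1.110) on both grids (part 42), (1.114) clauses 0∕1 on the fine grid (K-F), the bare defects (parts 52 at `γ = ⅛`, 59), the `c′`-rows M-C (front `G′`, from (1.110) «G∇*»)
and K-E (fronts `∇′G′`, from (1.114) «∇G∇*»); window `r₀ := (2((β + (d+2)β₂)(d+2)c_r) + 1)⁻¹`. [cite: Balaban1985BackgroundPropagators, (3.35) p.396, (3.52) p.400, (3.62)–(3.65) pp.402–403 (mechanism),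
Thm 3.1 (3.42) p.397 (entries 0–1: shape); Balaban1984PropagatorsI, Prop. 1.2 (1.110) p.35, (1.114) p.36; King1986, Prop. 3.9 (3.73) p.665 (rate factor), p.664 (pairing)] -/
theorem hasMajL2_idef_bgPair_gOp (hLodd : Odd L) (hL3 : 3 ≤ L) {a : ℝ} (ha : 0 < a) :
    ∃ δ r₀ B : ℝ, 0 < δ ∧ 0 < r₀ ∧ 0 < B ∧ ∀ (mT k m : ℕ) (hk : 1 ≤ k) (hL : Odd L ∧ 1 < L) (r : ℝ) (_hr : 0 ≤ r) (_hr₀ : r ≤ r₀) (oa : ℝ) (_hoa : 0 ≤ oa)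
      (c' : Tor (fine (L ^ m * L ^ k) (MP (paramsOf d L mT k hL))) × Fin (d + 1) → ℝ) (a' : Fin (d + 1) → Tor (fine (L ^ m * L ^ k) (MP (paramsOf d L mT k hL))) × Fin (d + 1) → ℝ)
      (_hc' : ∀ z, |c' z| ≤ r) (_ha' : ∀ μ z, |a' μ z| ≤ r)
      (_hfa : ∀ μ z, |a' μ z - blockAvg (kingPrV L k m (MP (paramsOf d L mT k hL))) (a' μ) (kingPrV L k m (MP (paramsOf d L mT k hL)) z)| ≤ oa),
      HasMaj (BlockNorm.ofBlocks (unitTorusGeo L k (MP (paramsOf d L mT k hL))) (blkFine L k (MP (paramsOf d L mT k hL))))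
        (BlockNorm.l2Blocks (unitTorusGeo L k (MP (paramsOf d L mT k hL)))
          (blkPair (J := Fin (d + 1)) fun i : Tor (fine (L ^ m * L ^ k) (MP (paramsOf d L mT k hL))) × Fin (d + 1) => blockOf (L ^ m * L ^ k) (MP (paramsOf d L mT k hL)) i.1)
          (etaPow (L ^ m * L ^ k) (d + 1)) (etaPow_nonneg _ _))
        (idef (pull (kingPrV L k m (MP (paramsOf d L mT k hL)))) (pull (liftPair (J := Fin (d + 1)) (kingPrV L k m (MP (paramsOf d L mT k hL)))))
          (bgPair (gOp (MP (paramsOf d L mT k hL)) (L ^ m * L ^ k) a)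
            (fun μ => symbOp (MP (paramsOf d L mT k hL)) (L ^ m * L ^ k) (sD (MP (paramsOf d L mT k hL)) (L ^ m * L ^ k) μ ((L ^ m * L ^ k : ℕ) : ℝ)) ∘ₗ
              gOp (MP (paramsOf d L mT k hL)) (L ^ m * L ^ k) a) c' a')
          (bgPair (gOp (MP (paramsOf d L mT k hL)) (L ^ k) a)
            (fun μ => symbOp (MP (paramsOf d L mT k hL)) (L ^ k) (sD (MP (paramsOf d L mT k hL)) (L ^ k) μ ((L ^ k : ℕ) : ℝ)) ∘ₗ gOp (MP (paramsOf d L mT k hL)) (L ^ k) a)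
            (blockAvg (kingPrV L k m (MP (paramsOf d L mT k hL))) c') (fun μ => blockAvg (kingPrV L k m (MP (paramsOf d L mT k hL))) (a' μ))))
        (fun y y' => B * (((L ^ k : ℕ) : ℝ) ^ (-(1 / 16 : ℝ)) + r * (((L ^ k : ℕ) : ℝ))⁻¹ + oa) * Real.exp (-(δ * tdistT (MP (paramsOf d L mT k hL)) y y'))) := by
  have hL2 : 2 ≤ L := by omega
  have hL : Odd L ∧ 1 < L := ⟨hLodd, by omega⟩
  -- the letters of record
  obtain ⟨δ₀, C, Cα, Cε, Cαε, hδ₀, hC, H110⟩ := ineq110_114_pair (d := d) hL ha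
  obtain ⟨δ₄, C₄, hδ₄, hC₄, HL2⟩ := hasMajL2_gOp_pair d hL ha
  obtain ⟨δ₁, D₁, hδ₁, hD₁, HDef⟩ := hasMaj_twoGridDefect (d := d) hLodd hL2 ha (γ := 1 / 8) (by norm_num) (by norm_num)
  obtain ⟨δ₂, D₂, hδ₂, hD₂, HDef1⟩ := hasMaj_twoGridDefect_grad (d := d) hLodd hL2 ha
  obtain ⟨δ₃, CE, hδ₃, hCE, HE⟩ := hasMajL2_gGrad_comp_idef_mulOp_blockAvg d hL ha
  -- common rate and constants
  set δm : ℝ := min (min δ₀ δ₄) (min (min δ₁ δ₂) δ₃) with hδm_def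
  have hδm : 0 < δm := lt_min (lt_min hδ₀ hδ₄) (lt_min (lt_min hδ₁ hδ₂) hδ₃)
  have eδ₀ : δm ≤ δ₀ := (min_le_left _ _).trans (min_le_left _ _)
  have eδ₄ : δm ≤ δ₄ := (min_le_left _ _).trans (min_le_right _ _)
  have eδ₁ : δm ≤ δ₁ := (min_le_right _ _).trans ((min_le_left _ _).trans (min_le_left _ _))
  have eδ₂ : δm ≤ δ₂ := (min_le_right _ _).trans ((min_le_left _ _).trans (min_le_right _ _))
  have eδ₃ : δm ≤ δ₃ := (min_le_right _ _).trans (min_le_right _ _)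
  have hσ : 0 < δm / 2 := by positivity
  set cr : ℝ := B4Sect5Proof.latticeConst (d + 1) (δm / 2) with hcr_def
  have hcr : 0 ≤ cr := B4Sect5Proof.latticeConst_nonneg (d + 1) hσ.le
  set u : ℝ := Real.sqrt ((d : ℝ) + 1) with hu_def
  have hu : 0 ≤ u := Real.sqrt_nonneg _
  set Cθ : ℝ := u * (D₁ + D₂) with hCθ_def
  have hCθ : 0 ≤ Cθ := by positivity
  set C₀ : ℝ := u * (2 * ((d : ℝ) + 1) * C) with hC₀_def
  have hC₀ : 0 ≤ C₀ := by positivity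
  set W : ℝ := (C + ((d : ℝ) + 2) * C₄) * ((d : ℝ) + 2) * cr with hW_def
  have hW : 0 ≤ W := by positivity
  have hr₀ : 0 < (2 * W + 1)⁻¹ := by positivity
  set r₀ : ℝ := (2 * W + 1)⁻¹ with hr₀_def
  refine ⟨δm / 2, r₀, 2 * ((d : ℝ) + 2) * cr * (Cθ * (1 + 2 * C * r₀ * ((d : ℝ) + 2)) + 2 * C * (C₀ + CE) + 2 * C * ((d : ℝ) + 1) * u * C) + 1, hσ, hr₀, by positivity, ?_⟩
  intro mT k m hk hL' r hr hrr₀ oa hoa c' a' hc' ha' hfa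
  have hkpos : (0 : ℝ) < ((L ^ k : ℕ) : ℝ) := by positivity
  have hn : 1 ≤ L ^ k := Nat.one_le_pow _ _ (by omega)
  have hn' : 1 ≤ L ^ m * L ^ k := Nat.one_le_iff_ne_zero.mpr (NeZero.ne _)
  have hmono : ∀ {F₁ F₂ : Type} [AddCommGroup F₁] [Module ℝ F₁] [AddCommGroup F₂] [Module ℝ F₂]
      {b₁ : BlockNorm (unitTorusGeo L k (MP (paramsOf d L mT k hL'))) F₁} {b₂ : BlockNorm (unitTorusGeo L k (MP (paramsOf d L mT k hL'))) F₂} {T : F₁ →ₗ[ℝ] F₂} {A A' t : ℝ},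
      0 ≤ A → A ≤ A' → δm ≤ t → HasMaj b₁ b₂ T (fun y y' => A * Real.exp (-(t * tdistT (MP (paramsOf d L mT k hL')) y y'))) →
      HasMaj b₁ b₂ T (fun y y' => A' * Real.exp (-(δm * tdistT (MP (paramsOf d L mT k hL')) y y'))) :=
    fun hA hAA' ht h => h.mono fun y y' => mul_le_mul hAA' (Real.exp_le_exp.mpr (by nlinarith [tdistT_nonneg (MP (paramsOf d L mT k hL')) y y'])) (Real.exp_nonneg _) (hA.trans hAA')
  -- (1.110) sup rows on both grids
  obtain ⟨Hc, Hf⟩ := H110 mT k m hk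
  have hG := hmono hC.le le_rfl eδ₀ (hasMaj_gOp_of_ineq (MP (paramsOf d L mT k hL')) k (L ^ k) a hn Hc hC.le)
  have hGD := fun μ : Fin (d + 1) => hmono hC.le le_rfl eδ₀ (hasMaj_grad_of_ineq (MP (paramsOf d L mT k hL')) k (L ^ k) a hn Hc hC.le μ)
  have hG' := hmono hC.le le_rfl eδ₀ (hasMaj_gOp_of_ineq (MP (paramsOf d L mT k hL')) k (L ^ m * L ^ k) a hn' Hf hC.le)
  have hG'D := fun μ : Fin (d + 1) => hmono hC.le le_rfl eδ₀ (hasMaj_grad_of_ineq (MP (paramsOf d L mT k hL')) k (L ^ m * L ^ k) a hn' Hf hC.le μ)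
  have hG'div := fun κ : Fin (d + 1) => hmono hC.le le_rfl eδ₀ (hasMaj_gDivAdj_of_ineq (MP (paramsOf d L mT k hL')) k (L ^ m * L ^ k) a hn' Hf hC.le κ)
  -- (1.114) clauses 0/1 on the fine grid
  have hmem : L ^ m * L ^ k ∈ ({L ^ k, L ^ m * L ^ k} : Finset ℕ) := by simp
  obtain ⟨H0, H1⟩ := HL2 mT k m hk (L ^ m * L ^ k) hmem inferInstance
  have hG'₂ := hmono hC₄.le le_rfl eδ₄ H0
  have hG'D₂ := fun μ : Fin (d + 1) => hmono hC₄.le le_rfl eδ₄ (H1 μ)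
  -- the bare defects, read into the fine L²-blocks
  have hθ : 0 ≤ ((L ^ k : ℕ) : ℝ) ^ (-(1 / 16 : ℝ)) := Real.rpow_nonneg hkpos.le _
  have hω : ∀ y : Tor (MP (paramsOf d L mT k hL')), etaPow (L ^ m * L ^ k) (d + 1) *
      ((univ.filter fun i : Tor (fine (L ^ m * L ^ k) (MP (paramsOf d L mT k hL'))) × Fin (d + 1) => blockOf (L ^ m * L ^ k) (MP (paramsOf d L mT k hL')) i.1 = y).card : ℝ) ≤ (d : ℝ) + 1 :=
    fun y => (etaPow_mul_card_fineBond (MP (paramsOf d L mT k hL')) (L ^ m * L ^ k) y).le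
  have hγ8 : (-((1 / 8 : ℝ) / 2)) = -(1 / 16 : ℝ) := by norm_num
  have hDG₀ := HDef mT k m hk hL'
  rw [hγ8] at hDG₀
  have hDG : HasMaj (BlockNorm.ofBlocks (unitTorusGeo L k (MP (paramsOf d L mT k hL'))) (blkFine L k (MP (paramsOf d L mT k hL'))))
      (BlockNorm.l2Blocks (unitTorusGeo L k (MP (paramsOf d L mT k hL')))
        (fun i : Tor (fine (L ^ m * L ^ k) (MP (paramsOf d L mT k hL'))) × Fin (d + 1) => blockOf (L ^ m * L ^ k) (MP (paramsOf d L mT k hL')) i.1)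
        (etaPow (L ^ m * L ^ k) (d + 1)) (etaPow_nonneg _ _))
      (idef (pull (kingPrV L k m (MP (paramsOf d L mT k hL')))) (pull (kingPrV L k m (MP (paramsOf d L mT k hL'))))
        (gOp (MP (paramsOf d L mT k hL')) (L ^ m * L ^ k) a) (gOp (MP (paramsOf d L mT k hL')) (L ^ k) a))
      (fun y y' => Cθ * ((L ^ k : ℕ) : ℝ) ^ (-(1 / 16 : ℝ)) * Real.exp (-(δm * tdistT (MP (paramsOf d L mT k hL')) y y'))) := by
    have h := HasMaj.to_l2Blocks (g := unitTorusGeo L k (MP (paramsOf d L mT k hL')))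
      (blk := fun i : Tor (fine (L ^ m * L ^ k) (MP (paramsOf d L mT k hL'))) × Fin (d + 1) => blockOf (L ^ m * L ^ k) (MP (paramsOf d L mT k hL')) i.1)
      (w := etaPow (L ^ m * L ^ k) (d + 1)) (etaPow_nonneg _ _) hω hDG₀
    have h' := hmono (A := u * (D₁ * ((L ^ k : ℕ) : ℝ) ^ (-(1 / 16 : ℝ)))) (A' := Cθ * ((L ^ k : ℕ) : ℝ) ^ (-(1 / 16 : ℝ))) (by positivity)
      (by rw [hCθ_def]; nlinarith [mul_nonneg hu (mul_nonneg hD₂.le hθ)]) eδ₁ (h.mono fun y y' => le_of_eq (by rw [hu_def]; ring))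
    exact h'
  have hDD : ∀ μ, HasMaj (BlockNorm.ofBlocks (unitTorusGeo L k (MP (paramsOf d L mT k hL'))) (blkFine L k (MP (paramsOf d L mT k hL'))))
      (BlockNorm.l2Blocks (unitTorusGeo L k (MP (paramsOf d L mT k hL')))
        (fun i : Tor (fine (L ^ m * L ^ k) (MP (paramsOf d L mT k hL'))) × Fin (d + 1) => blockOf (L ^ m * L ^ k) (MP (paramsOf d L mT k hL')) i.1)
        (etaPow (L ^ m * L ^ k) (d + 1)) (etaPow_nonneg _ _))
      (idef (pull (kingPrV L k m (MP (paramsOf d L mT k hL')))) (pull (kingPrV L k m (MP (paramsOf d L mT k hL'))))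
        (symbOp (MP (paramsOf d L mT k hL')) (L ^ m * L ^ k) (sD (MP (paramsOf d L mT k hL')) (L ^ m * L ^ k) μ ((L ^ m * L ^ k : ℕ) : ℝ)) ∘ₗ
          gOp (MP (paramsOf d L mT k hL')) (L ^ m * L ^ k) a)
        (symbOp (MP (paramsOf d L mT k hL')) (L ^ k) (sD (MP (paramsOf d L mT k hL')) (L ^ k) μ ((L ^ k : ℕ) : ℝ)) ∘ₗ gOp (MP (paramsOf d L mT k hL')) (L ^ k) a))
      (fun y y' => Cθ * ((L ^ k : ℕ) : ℝ) ^ (-(1 / 16 : ℝ)) * Real.exp (-(δm * tdistT (MP (paramsOf d L mT k hL')) y y'))) := by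
    intro μ
    have h := HasMaj.to_l2Blocks (g := unitTorusGeo L k (MP (paramsOf d L mT k hL')))
      (blk := fun i : Tor (fine (L ^ m * L ^ k) (MP (paramsOf d L mT k hL'))) × Fin (d + 1) => blockOf (L ^ m * L ^ k) (MP (paramsOf d L mT k hL')) i.1)
      (w := etaPow (L ^ m * L ^ k) (d + 1)) (etaPow_nonneg _ _) hω (HDef1 mT k m hk hL' μ)
    exact hmono (A := u * (D₂ * ((L ^ k : ℕ) : ℝ) ^ (-(1 / 16 : ℝ)))) (A' := Cθ * ((L ^ k : ℕ) : ℝ) ^ (-(1 / 16 : ℝ))) (by positivity)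
      (by rw [hCθ_def]; nlinarith [mul_nonneg hu (mul_nonneg hD₁.le hθ)]) eδ₂ (h.mono fun y y' => le_of_eq (by rw [hu_def]; ring))
  -- the `c′`-rows: front `G′` by M-C (sup, (1.110) «G∇*»), fronts `∇′G′` by K-E ((1.114) «∇G∇*»)
  have hx0 : 0 ≤ (((L ^ k : ℕ) : ℝ))⁻¹ := inv_nonneg.mpr hkpos.le
  have hGc : HasMaj (BlockNorm.ofBlocks (unitTorusGeo L k (MP (paramsOf d L mT k hL'))) (blkFine L k (MP (paramsOf d L mT k hL'))))
      (BlockNorm.l2Blocks (unitTorusGeo L k (MP (paramsOf d L mT k hL')))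
        (fun i : Tor (fine (L ^ m * L ^ k) (MP (paramsOf d L mT k hL'))) × Fin (d + 1) => blockOf (L ^ m * L ^ k) (MP (paramsOf d L mT k hL')) i.1)
        (etaPow (L ^ m * L ^ k) (d + 1)) (etaPow_nonneg _ _))
      (gOp (MP (paramsOf d L mT k hL')) (L ^ m * L ^ k) a ∘ₗ idef (pull (kingPrV L k m (MP (paramsOf d L mT k hL')))) (pull (kingPrV L k m (MP (paramsOf d L mT k hL'))))
        (mulOp c') (mulOp (blockAvg (kingPrV L k m (MP (paramsOf d L mT k hL'))) c')))
      (fun y y' => C₀ * r * (((L ^ k : ℕ) : ℝ))⁻¹ * Real.exp (-(δm * tdistT (MP (paramsOf d L mT k hL')) y y'))) := by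
    have hsup := hasMaj_comp_idef_mulOp_blockAvg_of_divAdj (MP (paramsOf d L mT k hL')) k m (fun y y' => mul_nonneg hC.le (Real.exp_nonneg _)) hr hc' (hG'div)
    have h := HasMaj.to_l2Blocks (g := unitTorusGeo L k (MP (paramsOf d L mT k hL')))
      (blk := fun i : Tor (fine (L ^ m * L ^ k) (MP (paramsOf d L mT k hL'))) × Fin (d + 1) => blockOf (L ^ m * L ^ k) (MP (paramsOf d L mT k hL')) i.1)
      (w := etaPow (L ^ m * L ^ k) (d + 1)) (etaPow_nonneg _ _) hω hsup
    refine h.mono fun y y' => le_of_eq ?_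
    rw [hC₀_def, hu_def]; ring
  have hDGc : ∀ ν, HasMaj (BlockNorm.ofBlocks (unitTorusGeo L k (MP (paramsOf d L mT k hL'))) (blkFine L k (MP (paramsOf d L mT k hL'))))
      (BlockNorm.l2Blocks (unitTorusGeo L k (MP (paramsOf d L mT k hL')))
        (fun i : Tor (fine (L ^ m * L ^ k) (MP (paramsOf d L mT k hL'))) × Fin (d + 1) => blockOf (L ^ m * L ^ k) (MP (paramsOf d L mT k hL')) i.1)
        (etaPow (L ^ m * L ^ k) (d + 1)) (etaPow_nonneg _ _))
      ((symbOp (MP (paramsOf d L mT k hL')) (L ^ m * L ^ k) (sD (MP (paramsOf d L mT k hL')) (L ^ m * L ^ k) ν ((L ^ m * L ^ k : ℕ) : ℝ)) ∘ₗ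
          gOp (MP (paramsOf d L mT k hL')) (L ^ m * L ^ k) a) ∘ₗ
        idef (pull (kingPrV L k m (MP (paramsOf d L mT k hL')))) (pull (kingPrV L k m (MP (paramsOf d L mT k hL')))) (mulOp c') (mulOp (blockAvg (kingPrV L k m (MP (paramsOf d L mT k hL'))) c')))
      (fun y y' => CE * r * (((L ^ k : ℕ) : ℝ))⁻¹ * Real.exp (-(δm * tdistT (MP (paramsOf d L mT k hL')) y y'))) :=
    fun ν => hmono (by positivity) le_rfl eδ₃ (HE mT k m hk ν c' r hr hc')
  -- the two guards
  have h1 : r₀ * (2 * W + 1) = 1 := inv_mul_cancel₀ (by positivity)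
  have hr₀W : r₀ * W ≤ 1 / 2 := by nlinarith [hr₀.le]
  have hq₁le : C * (r * ((d : ℝ) + 2)) * cr ≤ r₀ * W := by
    calc C * (r * ((d : ℝ) + 2)) * cr = r * (C * ((d : ℝ) + 2) * cr) := by ring
      _ ≤ r₀ * (C * ((d : ℝ) + 2) * cr) := mul_le_mul_of_nonneg_right hrr₀ (by positivity)
      _ ≤ r₀ * W := mul_le_mul_of_nonneg_left (by rw [hW_def]; nlinarith [mul_nonneg (by positivity : (0 : ℝ) ≤ ((d : ℝ) + 2) * C₄ * ((d : ℝ) + 2)) hcr]) hr₀.le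
  have hq₂le : ((d : ℝ) + 2) * C₄ * (r * ((d : ℝ) + 2)) * cr ≤ r₀ * W := by
    calc ((d : ℝ) + 2) * C₄ * (r * ((d : ℝ) + 2)) * cr = r * (((d : ℝ) + 2) * C₄ * ((d : ℝ) + 2) * cr) := by ring
      _ ≤ r₀ * (((d : ℝ) + 2) * C₄ * ((d : ℝ) + 2) * cr) := mul_le_mul_of_nonneg_right hrr₀ (by positivity)
      _ ≤ r₀ * W := mul_le_mul_of_nonneg_left (by rw [hW_def]; nlinarith [mul_nonneg (by positivity : (0 : ℝ) ≤ C * ((d : ℝ) + 2)) hcr]) hr₀.le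
  have hq : C * (r * ((d : ℝ) + 2)) * cr < 1 := by linarith
  have hq₂ : ((d : ℝ) + 2) * C₄ * (r * ((d : ℝ) + 2)) * cr < 1 := by linarith
  have hqinv0 : 0 ≤ (1 - C * (r * ((d : ℝ) + 2)) * cr)⁻¹ := inv_nonneg.mpr (by linarith)
  have hqinv2 : (1 - C * (r * ((d : ℝ) + 2)) * cr)⁻¹ ≤ 2 := by
    calc (1 - C * (r * ((d : ℝ) + 2)) * cr)⁻¹ ≤ (1 / 2)⁻¹ := inv_anti₀ (by norm_num) (by linarith)
      _ = 2 := by norm_num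
  have hq₂inv0 : 0 ≤ (1 - 1 * (((d : ℝ) + 2) * C₄ * (r * ((d : ℝ) + 2)) * cr))⁻¹ := inv_nonneg.mpr (by linarith)
  have hq₂inv2 : (1 - 1 * (((d : ℝ) + 2) * C₄ * (r * ((d : ℝ) + 2)) * cr))⁻¹ ≤ 2 := by
    calc (1 - 1 * (((d : ℝ) + 2) * C₄ * (r * ((d : ℝ) + 2)) * cr))⁻¹ ≤ (1 / 2)⁻¹ := inv_anti₀ (by norm_num) (by linarith)
      _ = 2 := by norm_num
  have hBX : C * (1 - C * (r * ((d : ℝ) + 2)) * cr)⁻¹ ≤ 2 * C := by nlinarith [mul_le_mul_of_nonneg_left hqinv2 hC.le]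
  -- §11
  have key := hasMajL2_idef_bgPair_of_rows (MP (paramsOf d L mT k hL')) k m hσ.le hcr (rowSum_unitTorusGeo L k (MP (paramsOf d L mT k hL')) hσ)
    (ρ := δm / 2) (δ := δm) hσ.le (by linarith) hC.le hC₄.le (mul_nonneg hCθ hθ) hr hoa (mul_nonneg (mul_nonneg hC₀ hr) hx0) (mul_nonneg (mul_nonneg hCE.le hr) hx0)
    (BX := 2 * C) hG hGD hG' hG'D hG'₂ hG'D₂ hDG hDD hGc hDGc hc' ha' hfa hq hq₂ hBX
  have hbd := jetL2_const_bound (s := (d : ℝ)) (Nat.cast_nonneg d) hu hθ hx0 hr hrr₀ hoa hC.le hcr hCθ hC₀ hCE.le hqinv0 hqinv2 hq₂inv0 hq₂inv2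
  refine key.mono fun y y' => ?_
  have hE := Real.exp_nonneg (-(δm / 2 * tdistT (MP (paramsOf d L mT k hL')) y y'))
  refine mul_le_mul_of_nonneg_right ?_ hE
  rw [hu_def] at hbd
  exact hbd

/-- ★★ **EVERY COMPONENT OF THE DRESSED JET OF THE PAIR OF RECORD — IN PARTICULAR THE DRESSED GRADIENT ENTRY `𝔇(∇′_νX′, ∇_νX̄)` (`j = some ν`) AND THE VALUE ENTRY (`j = none`) — in
(sup → L²-block) currency, HYPOTHESIS-FREE** (K-F ★ `hasMaj_projO_comp_l2`). [cite: Balaban1985BackgroundPropagators, Thm 3.1 (3.42) p.397 (entries 0 and 1: shape), (3.62)–(3.65) pp.402–403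
(mechanism); Balaban1984PropagatorsI, Prop. 1.2 (1.114) p.36] -/
theorem hasMajL2_projO_idef_bgPair_gOp (hLodd : Odd L) (hL3 : 3 ≤ L) {a : ℝ} (ha : 0 < a) :
    ∃ δ r₀ B : ℝ, 0 < δ ∧ 0 < r₀ ∧ 0 < B ∧ ∀ (mT k m : ℕ) (hk : 1 ≤ k) (hL : Odd L ∧ 1 < L) (r : ℝ) (_hr : 0 ≤ r) (_hr₀ : r ≤ r₀) (oa : ℝ) (_hoa : 0 ≤ oa)
      (c' : Tor (fine (L ^ m * L ^ k) (MP (paramsOf d L mT k hL))) × Fin (d + 1) → ℝ) (a' : Fin (d + 1) → Tor (fine (L ^ m * L ^ k) (MP (paramsOf d L mT k hL))) × Fin (d + 1) → ℝ)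
      (_hc' : ∀ z, |c' z| ≤ r) (_ha' : ∀ μ z, |a' μ z| ≤ r)
      (_hfa : ∀ μ z, |a' μ z - blockAvg (kingPrV L k m (MP (paramsOf d L mT k hL))) (a' μ) (kingPrV L k m (MP (paramsOf d L mT k hL)) z)| ≤ oa) (j : Option (Fin (d + 1))),
      HasMaj (BlockNorm.ofBlocks (unitTorusGeo L k (MP (paramsOf d L mT k hL))) (blkFine L k (MP (paramsOf d L mT k hL))))
        (BlockNorm.l2Blocks (unitTorusGeo L k (MP (paramsOf d L mT k hL)))
          (fun i : Tor (fine (L ^ m * L ^ k) (MP (paramsOf d L mT k hL))) × Fin (d + 1) => blockOf (L ^ m * L ^ k) (MP (paramsOf d L mT k hL)) i.1)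
          (etaPow (L ^ m * L ^ k) (d + 1)) (etaPow_nonneg _ _))
        (idef (pull (kingPrV L k m (MP (paramsOf d L mT k hL)))) (pull (kingPrV L k m (MP (paramsOf d L mT k hL))))
          (projO j ∘ₗ bgPair (gOp (MP (paramsOf d L mT k hL)) (L ^ m * L ^ k) a)
            (fun μ => symbOp (MP (paramsOf d L mT k hL)) (L ^ m * L ^ k) (sD (MP (paramsOf d L mT k hL)) (L ^ m * L ^ k) μ ((L ^ m * L ^ k : ℕ) : ℝ)) ∘ₗ
              gOp (MP (paramsOf d L mT k hL)) (L ^ m * L ^ k) a) c' a')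
          (projO j ∘ₗ bgPair (gOp (MP (paramsOf d L mT k hL)) (L ^ k) a)
            (fun μ => symbOp (MP (paramsOf d L mT k hL)) (L ^ k) (sD (MP (paramsOf d L mT k hL)) (L ^ k) μ ((L ^ k : ℕ) : ℝ)) ∘ₗ gOp (MP (paramsOf d L mT k hL)) (L ^ k) a)
            (blockAvg (kingPrV L k m (MP (paramsOf d L mT k hL))) c') (fun μ => blockAvg (kingPrV L k m (MP (paramsOf d L mT k hL))) (a' μ))))
        (fun y y' => B * (((L ^ k : ℕ) : ℝ) ^ (-(1 / 16 : ℝ)) + r * (((L ^ k : ℕ) : ℝ))⁻¹ + oa) * Real.exp (-(δ * tdistT (MP (paramsOf d L mT k hL)) y y'))) := by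
  obtain ⟨δ, r₀, B, hδ, hr₀, hB, H⟩ := hasMajL2_idef_bgPair_gOp d hLodd hL3 ha
  refine ⟨δ, r₀, B, hδ, hr₀, hB, fun mT k m hk hL r hr hrr₀ oa hoa c' a' hc' ha' hfa j => ?_⟩
  have h := H mT k m hk hL r hr hrr₀ oa hoa c' a' hc' ha' hfa
  exact (hasMaj_projO_comp_l2 (g := unitTorusGeo L k (MP (paramsOf d L mT k hL))) (etaPow_nonneg _ _) h j).congr fun v => funext fun x' => rfl

end Balaban

end Summit.QuantumFields.YangMills.BalabanUVNodes.N15.TwoGrid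

end
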